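import Summits.AtomisticToContinuum.HydrodynamicLimit.Theorems.CollisionIsometryCLTAdaptedWeightCLTBHEntropyBudgetEntropy
import Summits.AtomisticToContinuum.HydrodynamicLimit.Theorems.CollisionIsometryCLTAdaptedWeightCLTTLPastDampingKernel

/-!
# Entropy budget (stub `stub_entropyBudget`, line `block-h-dissipation-closure`, crux `AdaptedWeightCLT`,
stmt-AtomisticToContinuum-14868; `--supports`) — helper 4: the cell weights along a free flight, and
measurability of the cell objects in the location

Along the free flight `r ↦ freeFlight r w` only the positions move, `x_i(r) = x_i + r v_i`, so the cell
weight `cw_i(r, x) = ψ_N(x_i + r v_i − x)` is a smooth function of `r` with derivative the torus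
derivative of the kernel in the direction of the velocity,
`∂_r cw_i = Torus.fderiv ψ_N (x_i(r) − x) v_i` (tree `Torus.fderiv`, `IsSmooth.liftAt`):
* the SHIFT LEMMA (group property of free flight): a derivative at `0` for every start is a derivative
  everywhere;
* `|∂_r cw_i| ≤ L |v_i|` from the gradient bound `‖∇ψ_N‖ ≤ L` of an admissible kernel;
* `∂_r cw_i = 0` wherever `cw_i = 0` (a zero of a nonnegative smooth function is a minimum), so the
  derivative of the total weight vanishes on empty cells and `Σ_i |∂_r cw_i| ≤ L V #{i : cw_i ≠ 0}`;
* `cw_i(x) ≠ 0` only on the minimal-image ball of radius `(N+1)^{-γ}` about `x_i` (kernel support);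
* continuity of `x ↦ ∂_r cw_i` (the torus derivative of a smooth function is continuous) and Borel
  measurability in `x` of `ū_x, θ̄_x`, of `(x, v) ↦ f̃_x(v), f̂_x(v)` and of `x ↦ H(f̂_x)` (Fubini).
-/

namespace Summit.AtomisticToContinuum.HydrodynamicLimit.Theorems.BlockHDissipation

open scoped BigOperators Topology Classical MeasureTheory ENNReal InnerProductSpace
open Filter Set MeasureTheory
open Literature.Analysis.FluidPDE
open Literature.Analysis.FunctionSpaces (Torus.IsSmooth Torus.lift Torus.liftAt Torus.proj)
open Summit.AtomisticToContinuum.HydrodynamicLimit.Theorems.ContactSourceDuhamel (T3 V3 Cfg Vel Flow Flows)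
open Summit.AtomisticToContinuum.HydrodynamicLimit.Theorems.ContactSourceDuhamel.TimeLocal
open Literature.MathematicalPhysics.KineticTheory (localMaxwellian_pos localMaxwellian_nonneg continuous_localMaxwellian)

noncomputable section

namespace EntropyBudget

variable {N : ℕ} {ψ : ℕ → T3 → ℝ} {h δ : ℝ} (w : Cfg N) (x : T3)

/-! ## The shift lemma -/

/-- SHIFT LEMMA: free flight is a group, so a derivative at `r = 0` of `r ↦ Q(freeFlight r w')` for the
start `w' = freeFlight r₀ w` is a derivative at `r₀` of `r ↦ Q(freeFlight r w)`. -/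
theorem hasDerivAt_shift {E : Type*} [NormedAddCommGroup E] [NormedSpace ℝ E] (Q : Cfg N → E) {D : E}
    {r₀ : ℝ} (hQ : HasDerivAt (fun s => Q (freeFlight (Torus.geometry (Fin 3)) s
      (freeFlight (Torus.geometry (Fin 3)) r₀ w))) D 0) :
    HasDerivAt (fun s => Q (freeFlight (Torus.geometry (Fin 3)) s w)) D r₀ := by
  have e : (fun s => Q (freeFlight (Torus.geometry (Fin 3)) s w)) = fun s =>
      (fun s' => Q (freeFlight (Torus.geometry (Fin 3)) s' (freeFlight (Torus.geometry (Fin 3)) r₀ w)))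
        (s - r₀) := by
    funext s
    simp only [← freeFlight_add, sub_add_cancel]
  rw [e]
  exact HasDerivAt.comp_sub_const r₀ r₀ (by rwa [sub_self])

/-- The same for `deriv`: `deriv (r ↦ Q(freeFlight r w)) r₀ = deriv (r ↦ Q(freeFlight r (freeFlight r₀ w))) 0`
(no differentiability needed: `deriv_comp_sub_const`). -/
theorem deriv_shift {E : Type*} [NormedAddCommGroup E] [NormedSpace ℝ E] (Q : Cfg N → E) (r₀ : ℝ) :
    deriv (fun s => Q (freeFlight (Torus.geometry (Fin 3)) s w)) r₀ =
      deriv (fun s => Q (freeFlight (Torus.geometry (Fin 3)) s (freeFlight (Torus.geometry (Fin 3)) r₀ w))) 0 := by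
  set g : ℝ → E := fun s' => Q (freeFlight (Torus.geometry (Fin 3)) s' (freeFlight (Torus.geometry (Fin 3)) r₀ w))
    with hg
  have e : (fun s => Q (freeFlight (Torus.geometry (Fin 3)) s w)) = fun s => g (s - r₀) := by
    funext s
    simp only [hg, ← freeFlight_add, sub_add_cancel]
  rw [e, deriv_comp_sub_const, sub_self]

/-! ## The weights along a free flight -/

/-- Along the free flight the weight is the re-centred lift of the kernel on the line `r v_i`:
`cw_i(freeFlight r w, x) = liftAt ψ_N (x_i − x) (r v_i)`. -/
theorem cw_freeFlight (r : ℝ) (i : Fin (N + 1)) :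
    cw N ψ (freeFlight (Torus.geometry (Fin 3)) r w) x i = Torus.liftAt (ψ N) ((w i).1 - x) (r • (w i).2) := by
  simp only [cw, freeFlight_apply, Torus.geometry_translate, Literature.Analysis.FunctionSpaces.Torus.liftAt_apply]
  congr 1
  abel

/-- DERIVATIVE OF A WEIGHT at `r = 0`: `∂_r cw_i = Torus.fderiv ψ_N (x_i − x) v_i` (chain rule through the
smooth re-centred lift). -/
theorem hasDerivAt_cw (hψs : Torus.IsSmooth (ψ N)) (i : Fin (N + 1)) :
    HasDerivAt (fun s => cw N ψ (freeFlight (Torus.geometry (Fin 3)) s w) x i)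
      (Literature.Analysis.FunctionSpaces.Torus.fderiv (ψ N) ((w i).1 - x) (w i).2) 0 := by
  have e : (fun s => cw N ψ (freeFlight (Torus.geometry (Fin 3)) s w) x i) =
      fun s => Torus.liftAt (ψ N) ((w i).1 - x) (s • (w i).2) := funext fun s => cw_freeFlight w x s i
  rw [e]
  have hd : HasFDerivAt (Torus.liftAt (ψ N) ((w i).1 - x))
      (fderiv ℝ (Torus.liftAt (ψ N) ((w i).1 - x)) ((0 : ℝ) • (w i).2)) ((0 : ℝ) • (w i).2) :=
    ((hψs.liftAt _).differentiable (by simp)).differentiableAt.hasFDerivAt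
  have hl : HasDerivAt (fun s : ℝ => s • (w i).2) ((w i).2) 0 := by
    simpa using (hasDerivAt_id (0 : ℝ)).smul_const (w i).2
  have h := hd.comp_hasDerivAt (0 : ℝ) hl
  rw [zero_smul] at h
  exact h

/-- DERIVATIVE OF A WEIGHT at any `r`: `∂_r cw_i(r) = Torus.fderiv ψ_N (x_i(r) − x) v_i`. -/
theorem hasDerivAt_cw_at (hψs : Torus.IsSmooth (ψ N)) (i : Fin (N + 1)) (r : ℝ) :
    HasDerivAt (fun s => cw N ψ (freeFlight (Torus.geometry (Fin 3)) s w) x i)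
      (Literature.Analysis.FunctionSpaces.Torus.fderiv (ψ N)
        ((freeFlight (Torus.geometry (Fin 3)) r w i).1 - x) (w i).2) r :=
  hasDerivAt_shift w (fun w' => cw N ψ w' x i) (hasDerivAt_cw (freeFlight (Torus.geometry (Fin 3)) r w) x hψs i)

/-- The weights are continuous along the flight. -/
theorem continuous_cw_flight (hψs : Torus.IsSmooth (ψ N)) (i : Fin (N + 1)) :
    Continuous fun s => cw N ψ (freeFlight (Torus.geometry (Fin 3)) s w) x i :=
  continuous_iff_continuousAt.2 fun r => (hasDerivAt_cw_at w x hψs i r).continuousAt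

/-- The total weight is differentiable along the flight: `∂_r cW = Σ_i ∂_r cw_i`. -/
theorem hasDerivAt_cW (hψs : Torus.IsSmooth (ψ N)) :
    HasDerivAt (fun s => cW N ψ (freeFlight (Torus.geometry (Fin 3)) s w) x)
      (∑ i, Literature.Analysis.FunctionSpaces.Torus.fderiv (ψ N) ((w i).1 - x) (w i).2) 0 := by
  unfold cW
  exact HasDerivAt.fun_sum fun i _ => hasDerivAt_cw w x hψs i

/-- The total weight is continuous along the flight. -/
theorem continuous_cW_flight (hψs : Torus.IsSmooth (ψ N)) :
    Continuous fun s => cW N ψ (freeFlight (Torus.geometry (Fin 3)) s w) x := by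
  unfold cW
  exact continuous_finsetSum _ fun i _ => continuous_cw_flight w x hψs i

/-! ## Size, zeros and support of the weight derivatives -/

/-- GRADIENT BOUND: `|Torus.fderiv ψ_N q v| ≤ L |v|` when `‖∇ψ_N‖ ≤ L`. -/
theorem abs_torusFderiv_le {L : ℝ} (hL : ∀ y, ‖Literature.Analysis.FunctionSpaces.Torus.gradient (ψ N) y‖ ≤ L)
    (q : T3) (v : V3) : |Literature.Analysis.FunctionSpaces.Torus.fderiv (ψ N) q v| ≤ L * ‖v‖ := by
  have e : ‖Literature.Analysis.FunctionSpaces.Torus.fderiv (ψ N) q‖ =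
      ‖Literature.Analysis.FunctionSpaces.Torus.gradient (ψ N) q‖ := by
    rw [Literature.Analysis.FunctionSpaces.Torus.gradient, _root_.gradient,
      Literature.Analysis.FunctionSpaces.Torus.fderiv, LinearIsometryEquiv.norm_map]
  rw [← Real.norm_eq_abs]
  calc ‖Literature.Analysis.FunctionSpaces.Torus.fderiv (ψ N) q v‖
      ≤ ‖Literature.Analysis.FunctionSpaces.Torus.fderiv (ψ N) q‖ * ‖v‖ := ContinuousLinearMap.le_opNorm _ _
    _ ≤ L * ‖v‖ := by rw [e]; exact mul_le_mul_of_nonneg_right (hL q) (norm_nonneg _)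

/-- A gradient bound is nonnegative. -/
theorem L_nonneg {L : ℝ} (hL : ∀ y, ‖Literature.Analysis.FunctionSpaces.Torus.gradient (ψ N) y‖ ≤ L) : 0 ≤ L :=
  (norm_nonneg _).trans (hL 0)

/-- ZEROS: the torus derivative of a nonnegative kernel vanishes wherever the kernel does (a zero is a
minimum). -/
theorem torusFderiv_eq_zero_of (hψ : ∀ y, 0 ≤ ψ N y) {q : T3} (hq : ψ N q = 0) :
    Literature.Analysis.FunctionSpaces.Torus.fderiv (ψ N) q = 0 := by
  unfold Literature.Analysis.FunctionSpaces.Torus.fderiv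
  refine IsLocalMin.fderiv_eq_zero (Filter.Eventually.of_forall fun y => ?_)
  simp only [Literature.Analysis.FunctionSpaces.Torus.liftAt_apply, Literature.Analysis.FunctionSpaces.Torus.proj_zero,
    add_zero, hq]
  exact hψ _

/-- Hence `∂_r cw_i = 0` wherever `cw_i = 0`. -/
theorem dcw_eq_zero_of (hψ : ∀ y, 0 ≤ ψ N y) {i : Fin (N + 1)} (hi : cw N ψ w x i = 0) :
    Literature.Analysis.FunctionSpaces.Torus.fderiv (ψ N) ((w i).1 - x) (w i).2 = 0 := by
  rw [torusFderiv_eq_zero_of hψ hi]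
  rfl

/-- In an empty cell the derivative of the total weight vanishes. -/
theorem sum_dcw_eq_zero_of_cW (hψ : ∀ y, 0 ≤ ψ N y) (hS : cW N ψ w x = 0) :
    ∑ i, Literature.Analysis.FunctionSpaces.Torus.fderiv (ψ N) ((w i).1 - x) (w i).2 = 0 :=
  Finset.sum_eq_zero fun i _ => dcw_eq_zero_of w x hψ (cw_eq_zero_of_cW w x hψ hS i)

/-- COUNTING BOUND: `Σ_i |∂_r cw_i| ≤ L V #{i : cw_i ≠ 0}`. -/
theorem sum_abs_dcw_le (hψ : ∀ y, 0 ≤ ψ N y) {L V : ℝ}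
    (hL : ∀ y, ‖Literature.Analysis.FunctionSpaces.Torus.gradient (ψ N) y‖ ≤ L) (hV : ∀ i, ‖(w i).2‖ ≤ V) :
    ∑ i, |Literature.Analysis.FunctionSpaces.Torus.fderiv (ψ N) ((w i).1 - x) (w i).2| ≤
      L * V * ((Finset.univ.filter fun i => cw N ψ w x i ≠ 0).card : ℝ) := by
  have hL0 := L_nonneg hL
  rw [← Finset.sum_filter_add_sum_filter_not Finset.univ (fun i => cw N ψ w x i ≠ 0)]
  have hz : ∑ i ∈ Finset.univ.filter (fun i => ¬cw N ψ w x i ≠ 0),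
      |Literature.Analysis.FunctionSpaces.Torus.fderiv (ψ N) ((w i).1 - x) (w i).2| = 0 :=
    Finset.sum_eq_zero fun i hi => by
      rw [Finset.mem_filter, not_not] at hi
      rw [dcw_eq_zero_of w x hψ hi.2, abs_zero]
  rw [hz, add_zero]
  calc ∑ i ∈ Finset.univ.filter (fun i => cw N ψ w x i ≠ 0),
        |Literature.Analysis.FunctionSpaces.Torus.fderiv (ψ N) ((w i).1 - x) (w i).2|
      ≤ ∑ _i ∈ Finset.univ.filter (fun i => cw N ψ w x i ≠ 0), L * V :=
        Finset.sum_le_sum fun i _ => (abs_torusFderiv_le hL _ _).trans (mul_le_mul_of_nonneg_left (hV i) hL0)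
    _ = L * V * ((Finset.univ.filter fun i => cw N ψ w x i ≠ 0).card : ℝ) := by
        rw [Finset.sum_const, nsmul_eq_mul]; ring

/-- `|Σ_i ∂_r cw_i| ≤ Σ_i |∂_r cw_i|`. -/
theorem abs_sum_dcw_le :
    |∑ i, Literature.Analysis.FunctionSpaces.Torus.fderiv (ψ N) ((w i).1 - x) (w i).2| ≤
      ∑ i, |Literature.Analysis.FunctionSpaces.Torus.fderiv (ψ N) ((w i).1 - x) (w i).2| :=
  Finset.abs_sum_le_sum_abs _ _

/-- SUPPORT: `cw_i(x) ≠ 0` only on the minimal-image ball of radius `(N+1)^{-γ}` about `x_i`. -/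
theorem euclidDist_lt_of_cw_ne_zero {γ : ℝ}
    (hsupp : ∀ y, ((N : ℝ) + 1) ^ (-γ) ≤ Torus.euclidDist y 0 → ψ N y = 0) {i : Fin (N + 1)}
    (hi : cw N ψ w x i ≠ 0) : Torus.euclidDist x (w i).1 < ((N : ℝ) + 1) ^ (-γ) := by
  by_contra hge
  refine hi (hsupp ((w i).1 - x) ?_)
  rw [PastDamping.euclidDist_sub_zero, Torus.euclidDist_comm]
  exact not_lt.1 hge

/-! ## Continuity of the weight derivatives in the location -/

/-- The torus derivative of a smooth function is continuous (its lift is `D(lift ψ)`). -/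
theorem continuous_torusFderiv (hψs : Torus.IsSmooth (ψ N)) :
    Continuous (Literature.Analysis.FunctionSpaces.Torus.fderiv (ψ N)) := by
  rw [← Literature.Analysis.FunctionSpaces.Torus.continuous_lift_iff]
  have : Torus.lift (Literature.Analysis.FunctionSpaces.Torus.fderiv (ψ N)) = fderiv ℝ (Torus.lift (ψ N)) :=
    funext fun y => (Literature.Analysis.FunctionSpaces.Torus.fderiv_lift (ψ N) y).symm
  rw [this]
  exact hψs.continuous_fderiv (by simp)

/-- `x ↦ ∂_r cw_i(x)` is continuous. -/
theorem continuous_dcw (hψs : Torus.IsSmooth (ψ N)) (i : Fin (N + 1)) :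
    Continuous fun x => Literature.Analysis.FunctionSpaces.Torus.fderiv (ψ N) ((w i).1 - x) (w i).2 := by
  have h1 : Continuous fun x => Literature.Analysis.FunctionSpaces.Torus.fderiv (ψ N) ((w i).1 - x) :=
    (continuous_torusFderiv hψs).comp (continuous_const.sub continuous_id)
  fun_prop

/-! ## Measurability of the cell objects in the location -/

/-- `x ↦ cW_x` is continuous. -/
theorem continuous_cW (hψc : Continuous (ψ N)) : Continuous fun x => cW N ψ w x := by
  unfold cW
  exact continuous_finsetSum _ fun i _ => continuous_cw w hψc i

/-- `x ↦ ū_x` is Borel. -/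
theorem measurable_cU (hψc : Continuous (ψ N)) : Measurable fun x => cU N ψ w x := by
  have h1 : Measurable fun x => (cW N ψ w x)⁻¹ := (continuous_cW w hψc).measurable.inv
  have h2 : Measurable fun x => ∑ i, cw N ψ w x i • (w i).2 :=
    Finset.measurable_sum _ fun i _ => (continuous_cw w hψc i).measurable.smul_const _
  exact h1.smul h2

/-- `x ↦ θ̄_x` is Borel. -/
theorem measurable_cT (hψc : Continuous (ψ N)) : Measurable fun x => cT N ψ w x := by
  have h1 : Measurable fun x => (cW N ψ w x)⁻¹ := (continuous_cW w hψc).measurable.inv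
  have h2 : Measurable fun x => ∑ i, cw N ψ w x i * (‖(w i).2 - cU N ψ w x‖ ^ 2 / 3) :=
    Finset.measurable_sum _ fun i _ => (continuous_cw w hψc i).measurable.mul
      (((measurable_const.sub (measurable_cU w hψc)).norm.pow_const 2).div_const 3)
  exact h1.mul h2

/-- `(x, v) ↦ f̃_x(v)` is Borel. -/
theorem measurable_kde_uncurry (hψc : Continuous (ψ N)) :
    Measurable fun p : T3 × V3 => kde N ψ h w p.1 p.2 := by
  have h1 : Measurable fun p : T3 × V3 => (cW N ψ w p.1)⁻¹ :=
    ((continuous_cW w hψc).measurable.comp measurable_fst).inv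
  have h2 : Measurable fun p : T3 × V3 => ∑ i, cw N ψ w p.1 i * gauss h (w i).2 p.2 :=
    Finset.measurable_sum _ fun i _ => ((continuous_cw w hψc i).measurable.comp measurable_fst).mul
      ((continuous_localMaxwellian 1 (h ^ 2) (w i).2).measurable.comp measurable_snd)
  exact h1.mul h2

/-- The Maxwellian is jointly Borel in (temperature, centre, velocity) along measurable parameters. -/
theorem measurable_lM_param {α : Type*} [MeasurableSpace α] {θ : α → ℝ} {u v : α → V3} (hθ : Measurable θ)
    (hu : Measurable u) (hv : Measurable v) : Measurable fun a => localMaxwellian 1 (θ a) (u a) (v a) := by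
  unfold localMaxwellian
  refine (measurable_const.mul ((measurable_const.mul hθ).pow_const _)).mul (Real.measurable_exp.comp ?_)
  exact ((hv.sub hu).norm.pow_const 2).neg.div (measurable_const.mul hθ)

/-- `(x, v) ↦ f̂_x(v)` is Borel. -/
theorem measurable_cellLaw_uncurry (hψc : Continuous (ψ N)) :
    Measurable fun p : T3 × V3 => cellLaw N ψ h δ w p.1 p.2 := by
  unfold cellLaw
  refine (measurable_const.mul (measurable_kde_uncurry w hψc)).add (measurable_const.mul ?_)
  exact measurable_lM_param (((measurable_cT w hψc).comp measurable_fst).add_const _)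
    ((measurable_cU w hψc).comp measurable_fst) measurable_snd

/-- `x ↦ H(f̂_x)` is Borel (Fubini measurability of a jointly Borel integrand). -/
theorem measurable_cellEnt (hψc : Continuous (ψ N)) : Measurable fun x => cellEnt N ψ h δ w x := by
  have hm : Measurable fun p : T3 × V3 => cellLaw N ψ h δ w p.1 p.2 * Real.log (cellLaw N ψ h δ w p.1 p.2) :=
    (measurable_cellLaw_uncurry w hψc).mul (Real.measurable_log.comp (measurable_cellLaw_uncurry w hψc))
  exact (hm.stronglyMeasurable.integral_prod_right' (ν := (volume : Measure V3))).measurable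

end EntropyBudget

/-- Registered anchor of this helper file (`--supports stmt-AtomisticToContinuum-14868`, helper of
`stub_entropyBudget`): the cell weights are differentiable along a free flight, with derivative the torus
derivative of the kernel along the velocity. -/
theorem bhEntropyBudget_weights_anchor : ∀ (N : ℕ) (ψ : ℕ → T3 → ℝ) (w : Cfg N) (x : T3) (i : Fin (N + 1)) (r : ℝ), Literature.Analysis.FunctionSpaces.Torus.IsSmooth (ψ N) → HasDerivAt (fun s => cw N ψ (Literature.Analysis.FluidPDE.freeFlight (Literature.Analysis.FluidPDE.Torus.geometry (Fin 3)) s w) x i) (Literature.Analysis.FunctionSpaces.Torus.fderiv (ψ N) ((Literature.Analysis.FluidPDE.freeFlight (Literature.Analysis.FluidPDE.Torus.geometry (Fin 3)) r w i).1 - x) (w i).2) r :=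
  fun _ _ w x i r hψs => EntropyBudget.hasDerivAt_cw_at w x hψs i r

end

end Summit.AtomisticToContinuum.HydrodynamicLimit.Theorems.BlockHDissipation
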